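import Summits.HodgeConjecture.HodgeConjecture.Theorems.Ring2WeilCoverageCyclotomicUnitProducts
import Mathlib.RingTheory.RootsOfUnity.CyclotomicUnits
import HarnessLib

/-!
# Weil-type family coverage — the real cyclotomic units `ζ^c(1 + ζ + ⋯ + ζ^{a−1})` of `ℚ(ζₙ)`, EVERY level `n`
# (prime powers included): units of `𝓞 K` fixed by conjugation with `φ_t = sin(πat/n)/sin(πt/n)`

research route conditional on HC_CM; not a corollary; Q11.4-sentence-2 already refuted in dim ≥ 3.

Ring 2, WEIL-TYPE FAMILY-COVERAGE CENSUS (`HOME/WEIL-FAMILY-COVERAGE.md` `## b01`, blocks b01.23 (A)/(D) «ALL THIRTY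
g = 8 classes (ℚ(ζ₃₂), ℚ(ζ₄₀), ℚ(ζ₄₈), ℚ(ζ₆₀)) YES» and b01.28 THEOREM L, owner ring2-b01), part 20 of the
`Ring2WeilCoverage*` series.  Part 13's units `ζ^h(1 − ζ^a)(1 − ζ^b)` need the orders of `ζ^a`, `ζ^b` NOT to be prime
powers, so they do not exist at the census level `M = 32 = 2⁵` (`h(ℚ(ζ₃₂)) = 1`, `g = 8`, `K = ℚ(i), ℚ(√−2)`).  This
file provides the second classical family, valid at EVERY level: for `a` prime to `n` and `2c + a − 1 ≡ 0 (mod 2n)`,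
`v(a, c) := ζ^c·(1 + ζ + ⋯ + ζ^{a−1}) = ζ^c(1 − ζ^a)/(1 − ζ)` (Mathlib `IsPrimitiveRoot.geom_sum_isUnit`):

* §1 **`embedding_geomSum_eq`: for `φ ζ = 𝐞(t)` (`t` a unit residue), `φ(v(a,c)) = sin(πat/n)/sin(πt/n)`** (the
  phase `e^{iπt(2c+a−1)/n}` is `1`); `re_embedding_geomSum`: **`Re φ(v) < 0 ↔ n < at mod 2n`**, real, non-zero.
* §2 signed products over a finite set `A` of admissible pairs `(a, c)` (`a` prime to `n`, `2 ≤ n`,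
  `(2c + a − 1) mod 2n = 0`): `re_embedding_prod_geomSum_neg_iff` (sign = parity of `#{x ∈ A : n < a_x t mod 2n} + [ε]`)
  and **`exists_units_coe_eq_geomSum`: `± ∏_{x∈A} v(x)` is a unit of `𝓞 K` FIXED BY COMPLEX CONJUGATION**.

HONEST FRAMING: elementary algebra and trigonometry for an arbitrary number field `K ∋ ζ`; nothing here mentions
Hodge classes, `W_K` or HC; `HC_CM` is used nowhere.  No `def`, no named fact, no `sorry`.  Part 21
(`…CyclotomicUnitSignaturesFamily`) is part 14 for an ABSTRACT unit family; part 22 instantiates it with this family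
at `M = 32`.

References: [cite: Washington1997, §8.1, Lemma 8.1 (the units `ξ_a = ζ^{(1−a)/2}(1 − ζ^a)/(1 − ζ)`)]; census
b01.23 (A) / b01.28 (seat-derived).
-/

noncomputable section

open Polynomial NumberField Complex Finset
open scoped Real

namespace Summit.HodgeConjecture.Ring2WeilCoverage.CyclotomicUnitGeomSums

open Summit.HodgeConjecture.Ring2WeilCoverage.CyclotomicSkewSigns (toCircle_coe_eq_exp two_mul_I_mul_sin)
open Summit.HodgeConjecture.Ring2WeilCoverage.CyclotomicUnitProducts
  (one_sub_exp_two_mul toCircle_pow_eq_exp_two_mul sin_pi_mul_div_neg_iff)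
open Summit.HodgeConjecture.Ring2WeilCoverage.CMTypeSignParity (prod_pos_iff_even_card_filter_neg)
open Literature.AlgebraicGeometry.ComplexMultiplication.CyclotomicCMType (exists_apply_eq_toCircle)

variable {K : Type} [Field K] [NumberField K] {n : ℕ} [NeZero n] {ζ : K}

/-- `𝐞(t) = exp(2πi t/n) ∈ ℂ` (`ZMod.toCircle`). -/
local notation3 (prettyPrint := false) "𝐞 " t:max => ((ZMod.toCircle t : Circle) : ℂ)

/-- the generator `v(x) = ζ^c · Σ_{j<a} ζ^j` for `x = (a, c)`. -/
local notation3 (prettyPrint := false) "𝐯 " x:max =>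
  (ζ ^ (x : ℕ × ℕ).2 * ∑ j ∈ Finset.range (x : ℕ × ℕ).1, ζ ^ j)

/-- admissibility of a pair `x = (a, c)`: `a` prime to `n`, `(2c + a − 1) mod 2n = 0` (so `a ≥ 1`). -/
local notation3 (prettyPrint := false) "AdmG " x:max =>
  (Nat.Coprime (x : ℕ × ℕ).1 n ∧ (2 * (x : ℕ × ℕ).2 + (x : ℕ × ℕ).1 - 1) % (2 * n) = 0 ∧ 1 ≤ (x : ℕ × ℕ).1)

/-! ### §1 The embedding value `φ(ζ^c(1 + ζ + ⋯ + ζ^{a−1})) = sin(πat/n)/sin(πt/n)` and its sign -/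

omit [NumberField K] in
/-- **`φ(ζ^c·Σ_{j<a} ζ^j) = sin(πat/n)/sin(πt/n)`** for an embedding `φ` with `φ ζ = 𝐞(t)`, `t` a unit residue of a
level `n ≥ 2`, `a ≥ 1` and `2c + a − 1 ≡ 0 (mod 2n)`:  `Σ_{j<a} z^j = (1 − z^a)/(1 − z)` with
`1 − e^{2ix} = −2i·sin x·e^{ix}`, and the phase `e^{iπt(2c + a − 1)/n}` is `1`.
research route conditional on HC_CM; not a corollary; Q11.4-sentence-2 already refuted in dim ≥ 3. [cite: Washington1997, §8.1, Lemma 8.1] -/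
theorem embedding_geomSum_eq (hn : 2 ≤ n) {φ : K →+* ℂ} {t : ZMod n} (hφ : φ ζ = 𝐞 t) (ht : t.val.Coprime n)
    {a c : ℕ} (ha : 1 ≤ a) (hc : (2 * c + a - 1) % (2 * n) = 0) :
    φ (ζ ^ c * ∑ j ∈ Finset.range a, ζ ^ j) =
      ((Real.sin (π * ((a * t.val : ℕ) : ℝ) / n) / Real.sin (π * ((1 * t.val : ℕ) : ℝ) / n) : ℝ) : ℂ) := by
  have hdm := Nat.div_add_mod (2 * c + a - 1) (2 * n)
  rw [hc, add_zero] at hdm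
  obtain ⟨q, hq⟩ : ∃ q, 2 * c + a - 1 = 2 * n * q := ⟨(2 * c + a - 1) / (2 * n), hdm.symm⟩
  have hq' : 2 * c + a = 2 * n * q + 1 := by omega
  set θ : ℂ := π * (t.val : ℂ) / (n : ℂ) with hθ
  -- the denominator `sin(πt/n)` is non-zero (`0 < t < n`)
  have h1t : ¬ n ∣ 1 := fun h => by have := Nat.le_of_dvd one_pos h; omega
  obtain ⟨-, hs1⟩ := sin_pi_mul_div_neg_iff ht h1t
  have hz1 : (1 : ℂ) - 𝐞 t ≠ 0 := by
    rw [show (𝐞 t) = (𝐞 t) ^ 1 from (pow_one _).symm, toCircle_pow_eq_exp_two_mul t 1, one_sub_exp_two_mul]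
    refine mul_ne_zero (neg_ne_zero.mpr (mul_ne_zero (mul_ne_zero two_ne_zero Complex.I_ne_zero) ?_))
      (Complex.exp_ne_zero _)
    rw [show ((1 : ℕ) : ℂ) * (π * (t.val : ℂ) / (n : ℂ)) = ((π * ((1 * t.val : ℕ) : ℝ) / n : ℝ) : ℂ) by
      push_cast; ring, ← Complex.ofReal_sin]
    exact Complex.ofReal_ne_zero.mpr hs1
  have hgeom : (∑ j ∈ Finset.range a, (𝐞 t) ^ j) * (1 - 𝐞 t) = 1 - (𝐞 t) ^ a := by
    have := geom_sum_mul_neg (𝐞 t) a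
    simpa [mul_comm] using this
  have hval : φ (ζ ^ c * ∑ j ∈ Finset.range a, ζ ^ j) = (𝐞 t) ^ c * ((1 - (𝐞 t) ^ a) / (1 - 𝐞 t)) := by
    simp only [map_mul, map_sum, map_pow, hφ]
    congr 1
    rw [eq_div_iff hz1, hgeom]
  rw [hval, show (𝐞 t) = (𝐞 t) ^ 1 from (pow_one _).symm, ← pow_mul, ← pow_mul, one_mul, one_mul,
    toCircle_pow_eq_exp_two_mul t a, toCircle_pow_eq_exp_two_mul t 1, toCircle_pow_eq_exp_two_mul t c,
    one_sub_exp_two_mul, one_sub_exp_two_mul]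
  have hsa : Complex.sin ((a : ℂ) * θ) = ((Real.sin (π * ((a * t.val : ℕ) : ℝ) / n) : ℝ) : ℂ) := by
    rw [Complex.ofReal_sin]; congr 1; rw [hθ]; push_cast; ring
  have hs1' : Complex.sin (((1 : ℕ) : ℂ) * θ) = ((Real.sin (π * ((1 * t.val : ℕ) : ℝ) / n) : ℝ) : ℂ) := by
    rw [Complex.ofReal_sin]; congr 1; rw [hθ]; push_cast; ring
  have hsin1 : Complex.sin (((1 : ℕ) : ℂ) * θ) ≠ 0 := by rw [hs1']; exact Complex.ofReal_ne_zero.mpr hs1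
  have hphase : cexp (2 * ((c : ℂ) * θ) * I) * cexp ((a : ℂ) * θ * I) = cexp (((1 : ℕ) : ℂ) * θ * I) := by
    rw [← Complex.exp_add]
    have hn0 : (n : ℂ) ≠ 0 := Nat.cast_ne_zero.mpr (NeZero.ne n)
    have : 2 * ((c : ℂ) * θ) * I + (a : ℂ) * θ * I = ((1 : ℕ) : ℂ) * θ * I + ((q * t.val : ℕ) : ℂ) * (2 * π * I) := by
      calc 2 * ((c : ℂ) * θ) * I + (a : ℂ) * θ * I = ((2 * c + a : ℕ) : ℂ) * θ * I := by push_cast; ring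
        _ = ((2 * n * q + 1 : ℕ) : ℂ) * θ * I := by rw [hq']
        _ = ((1 : ℕ) : ℂ) * θ * I + ((q * t.val : ℕ) : ℂ) * (2 * π * I) := by rw [hθ]; push_cast; field_simp; ring
    rw [this, Complex.exp_add, Complex.exp_nat_mul_two_pi_mul_I, mul_one]
  rw [hθ.symm] at *
  have hexp1 : cexp (((1 : ℕ) : ℂ) * θ * I) ≠ 0 := Complex.exp_ne_zero _
  rw [← mul_div_assoc, div_eq_iff (mul_ne_zero (neg_ne_zero.mpr (mul_ne_zero (mul_ne_zero two_ne_zero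
    Complex.I_ne_zero) hsin1)) hexp1)]
  calc cexp (2 * ((c : ℂ) * θ) * I) * (-(2 * I * Complex.sin ((a : ℂ) * θ)) * cexp ((a : ℂ) * θ * I))
      = -(2 * I * Complex.sin ((a : ℂ) * θ)) * (cexp (2 * ((c : ℂ) * θ) * I) * cexp ((a : ℂ) * θ * I)) := by ring
    _ = -(2 * I * Complex.sin ((a : ℂ) * θ)) * cexp (((1 : ℕ) : ℂ) * θ * I) := by rw [hphase]
    _ = _ := by
      rw [hsa, hs1']
      have h0 : ((Real.sin (π * ((1 * t.val : ℕ) : ℝ) / n) : ℝ) : ℂ) ≠ 0 := Complex.ofReal_ne_zero.mpr hs1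
      rw [Complex.ofReal_div, div_mul_eq_mul_div, eq_div_iff h0]
      ring

omit [NumberField K] in
/-- **`Re φ(v(a,c)) < 0 ↔ n < at mod 2n`** — `v = ζ^c·Σ_{j<a} ζ^j` is NEGATIVE at the place reading the unit residue
`t` iff `sin(πat/n) < 0` (the denominator `sin(πt/n)` is positive, `0 < t < n`) — and `φ(v)` is a NON-ZERO REAL
number (`n ≥ 2`, `a ≥ 1` prime to `n`, `2c + a − 1 ≡ 0 (mod 2n)`).
research route conditional on HC_CM; not a corollary; Q11.4-sentence-2 already refuted in dim ≥ 3. [folklore] -/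
theorem re_embedding_geomSum (hn : 2 ≤ n) {φ : K →+* ℂ} {t : ZMod n} (hφ : φ ζ = 𝐞 t) (ht : t.val.Coprime n)
    {a c : ℕ} (hcop : a.Coprime n) (ha : 1 ≤ a) (hc : (2 * c + a - 1) % (2 * n) = 0) :
    ((φ (ζ ^ c * ∑ j ∈ Finset.range a, ζ ^ j)).re < 0 ↔ n < a * t.val % (2 * n)) ∧
      (φ (ζ ^ c * ∑ j ∈ Finset.range a, ζ ^ j)).re ≠ 0 ∧
      (φ (ζ ^ c * ∑ j ∈ Finset.range a, ζ ^ j)).im = 0 := by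
  rw [embedding_geomSum_eq hn hφ ht ha hc, Complex.ofReal_re, Complex.ofReal_im]
  have hna : ¬ n ∣ a := fun h => by
    have : Nat.gcd a n = n := Nat.gcd_eq_right h
    rw [hcop] at this
    omega
  have h1t : ¬ n ∣ 1 := fun h => by have := Nat.le_of_dvd one_pos h; omega
  obtain ⟨hsa, hsa0⟩ := sin_pi_mul_div_neg_iff ht hna
  obtain ⟨hs1, hs10⟩ := sin_pi_mul_div_neg_iff ht h1t
  set sa := Real.sin (π * ((a * t.val : ℕ) : ℝ) / n)
  set s1 := Real.sin (π * ((1 * t.val : ℕ) : ℝ) / n)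
  have hs1pos : 0 < s1 := by
    have hlt : ¬ n < 1 * t.val % (2 * n) := by
      have := ZMod.val_lt t
      rw [one_mul, Nat.mod_eq_of_lt (by omega)]
      omega
    rw [← hs1] at hlt
    exact lt_of_le_of_ne (not_lt.mp hlt) hs10.symm
  refine ⟨?_, div_ne_zero hsa0 hs10, rfl⟩
  rw [div_neg_iff, ← hsa]
  constructor
  · rintro (⟨-, h⟩ | ⟨h, -⟩)
    · exact absurd h (not_lt.mpr hs1pos.le)
    · exact h
  · exact fun h => Or.inr ⟨h, hs1pos⟩

/-! ### §2 Signed products of admissible generators -/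

omit [NumberField K] in
/-- **Sign of a signed product**: for a finite set `A` of admissible pairs `(a, c)`, a sign `ε`, and `φ ζ = 𝐞(t)`
(`t` a unit residue, `n ≥ 2`): `Re φ(± ∏_{x∈A} v(x)) < 0 ↔ #{x ∈ A : n < a_x t mod 2n} + [ε]` is odd; and the real
part is non-zero (all `φ(v(x))` are real; part 1's `prod_pos_iff_even_card_filter_neg`).
research route conditional on HC_CM; not a corollary; Q11.4-sentence-2 already refuted in dim ≥ 3. [folklore] -/
theorem re_embedding_prod_geomSum_neg_iff (hn : 2 ≤ n) {φ : K →+* ℂ} {t : ZMod n} (hφ : φ ζ = 𝐞 t)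
    (ht : t.val.Coprime n) (A : Finset (ℕ × ℕ)) (hA : ∀ x ∈ A, AdmG x) (ε : Bool) :
    ((φ ((if ε then -1 else 1) * ∏ x ∈ A, 𝐯 x)).re < 0 ↔
        Odd ((A.filter fun x => n < x.1 * t.val % (2 * n)).card + (if ε then 1 else 0))) ∧
      (φ ((if ε then -1 else 1) * ∏ x ∈ A, 𝐯 x)).re ≠ 0 := by
  have hgen : ∀ x ∈ A, ((φ (𝐯 x)).re < 0 ↔ n < x.1 * t.val % (2 * n)) ∧ (φ (𝐯 x)).re ≠ 0 ∧ (φ (𝐯 x)).im = 0 :=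
    fun x hx => re_embedding_geomSum hn hφ ht (hA x hx).1 (hA x hx).2.2 (hA x hx).2.1
  have hreal : ∀ x ∈ A, φ (𝐯 x) = (((φ (𝐯 x)).re : ℝ) : ℂ) := fun x hx =>
    Complex.ext (by simp) (by rw [Complex.ofReal_im]; exact (hgen x hx).2.2)
  have hprod : φ (∏ x ∈ A, 𝐯 x) = ((∏ x ∈ A, (φ (𝐯 x)).re : ℝ) : ℂ) := by
    rw [map_prod, Complex.ofReal_prod]
    exact Finset.prod_congr rfl hreal
  have hne : ∀ x ∈ A, (φ (𝐯 x)).re ≠ 0 := fun x hx => (hgen x hx).2.1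
  have hP : ∏ x ∈ A, (φ (𝐯 x)).re ≠ 0 := Finset.prod_ne_zero_iff.mpr hne
  have hpos := prod_pos_iff_even_card_filter_neg A (fun x => (φ (𝐯 x)).re) hne
  have hfilter : (A.filter fun x => (φ (𝐯 x)).re < 0) = A.filter fun x => n < x.1 * t.val % (2 * n) :=
    Finset.filter_congr fun x hx => (hgen x hx).1
  rw [hfilter] at hpos
  rw [map_mul, hprod]
  cases ε
  · simp only [Bool.false_eq_true, ↓reduceIte, map_one, one_mul, Complex.ofReal_re, add_zero]
    refine ⟨?_, hP⟩
    rw [← Nat.not_even_iff_odd, ← hpos, not_lt]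
    exact ⟨fun h => h.le, fun h => lt_of_le_of_ne h hP⟩
  · simp only [↓reduceIte, map_neg, map_one, neg_mul, one_mul, Complex.neg_re, Complex.ofReal_re, neg_lt_zero,
      ne_eq, neg_eq_zero]
    refine ⟨?_, hP⟩
    rw [hpos, Nat.odd_add_one, Nat.not_odd_iff_even]

/-- **`± ∏_{x∈A} ζ^{c_x}(1 + ζ + ⋯ + ζ^{a_x − 1})` is a unit of `𝓞 K` fixed by complex conjugation** for a finite set
`A` of admissible pairs (`a_x` prime to `n`, `2c_x + a_x − 1 ≡ 0 (mod 2n)`), `K` a CM field containing the primitive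
`n`-th root of unity `ζ`, `n ≥ 2`: each geometric sum is a unit (Mathlib `IsPrimitiveRoot.geom_sum_isUnit`), `ζ^c`
is a unit, and reality is read through an embedding (§1).
research route conditional on HC_CM; not a corollary; Q11.4-sentence-2 already refuted in dim ≥ 3. [cite: Washington1997, §8.1, Lemma 8.1] -/
theorem exists_units_coe_eq_geomSum [IsCMField K] (hn : 2 ≤ n) (hζ : IsPrimitiveRoot ζ n) {A : Finset (ℕ × ℕ)}
    (hA : ∀ x ∈ A, AdmG x) (ε : Bool) :
    ∃ u : (𝓞 K)ˣ, ((u : 𝓞 K) : K) = (if ε then -1 else 1) * ∏ x ∈ A, 𝐯 x ∧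
      IsCMField.complexConj K ((u : 𝓞 K) : K) = ((u : 𝓞 K) : K) := by
  classical
  set U : 𝓞 K := (if ε then -1 else 1) *
    ∏ x ∈ A, (hζ.toInteger ^ x.2 * ∑ j ∈ Finset.range x.1, hζ.toInteger ^ j) with hUdef
  have hUK : (U : K) = (if ε then -1 else 1) * ∏ x ∈ A, 𝐯 x := by
    rw [hUdef]; cases ε <;> push_cast <;> rfl
  have hζ' : IsPrimitiveRoot (hζ.toInteger : 𝓞 K) n := hζ.toInteger_isPrimitiveRoot
  have hζU : IsUnit (hζ.toInteger : 𝓞 K) := hζ'.isUnit (NeZero.ne n)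
  have hU : IsUnit U := by
    refine IsUnit.mul (by cases ε <;> simp) ?_
    refine Finset.prod_induction _ IsUnit (fun a b ha hb => ha.mul hb) isUnit_one fun x hx => ?_
    exact (hζU.pow _).mul (hζ'.geom_sum_isUnit hn (hA x hx).1)
  obtain ⟨u, hu⟩ := hU
  refine ⟨u, by rw [hu, hUK], ?_⟩
  rw [hu, hUK]
  obtain ⟨φ⟩ := (inferInstance : Nonempty (K →+* ℂ))
  obtain ⟨t, ht, hφt⟩ := exists_apply_eq_toCircle hζ φ
  apply φ.injective
  rw [IsCMField.complexEmbedding_complexConj]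
  have him : ∀ x ∈ A, (φ (𝐯 x)).im = 0 := fun x hx =>
    (re_embedding_geomSum hn hφt ht (hA x hx).1 (hA x hx).2.2 (hA x hx).2.1).2.2
  have hreal : φ (∏ x ∈ A, 𝐯 x) = ((∏ x ∈ A, (φ (𝐯 x)).re : ℝ) : ℂ) := by
    rw [map_prod, Complex.ofReal_prod]
    exact Finset.prod_congr rfl fun x hx => Complex.ext (by simp) (by rw [Complex.ofReal_im]; exact him x hx)
  rw [map_mul, hreal]
  cases ε <;> simp [Complex.conj_ofReal]

end Summit.HodgeConjecture.Ring2WeilCoverage.CyclotomicUnitGeomSums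

end
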